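import Summits.HubbardSuperconductivity.HubbardSuperconductivity.Theorems.ThermalWedgeTwSeededEnsembleEquivalenceRColdEdgeGlue
import Summits.HubbardSuperconductivity.HubbardSuperconductivity.Theorems.ThermalWedgeTwSeededEnsembleEquivalenceRFreePairEnergyBandBottom
import Summits.HubbardSuperconductivity.HubbardSuperconductivity.Theorems.ThermalWedgeTwSeededEnsembleEquivalenceRFreeDensityBandBottom
import Summits.HubbardSuperconductivity.HubbardSuperconductivity.Theorems.ThermalWedgeTwSeededEnsembleEquivalenceRFreeDensityNearHalfFilling

/-!
# Crux `TwSeededEnsembleEquivalenceR` (stmt-HubbardSuperconductivity-15581), line `cold-floor-collapse` (slug `Sketch`),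
# skeleton v8 (block two-phase pinning) — registered stub `stub_coldEdgeSweep` (S7a)

Support file (`--supports stmt-HubbardSuperconductivity-15581`; sorry-free; no definition; route-file free).
EDGE in subgradient form + sweep (real analysis on the cold limit pressure). With `q(μ,h)` the thermodynamic
limit of the sourced torus pressure at the cold slice `β = e^{a/U} ≥ 20000` on the window
`W = [−399/100, −1/400000]` × box `[−(13g+1), 13g+1]` and `B(μ) = sup_h [q μ h − h²/g]` the limiting seeded
pressure, the stub produces `μs ∈ [−99/25, −1/200000]` at which the target density `1 − δ` (`δ ∈ [1/10, 2/5]`)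
is a subgradient of `B` relative to the whole window.

* (1) `q` inherits from finite volume: convexity in `μ` on `W` (`cfb_convexOn_sourcedPressure`,
  `cfc_convexOn_of_limit`), the `2`-Lipschitz bound in `μ` (`cfb_abs_sourcedPressure_sub_mu_le`) and a Lipschitz
  bound in `h` (`cfc_abs_sourcedPressure_sub_h_le`), and the free sandwich `q₀(μ−U/2,·) ≤ q(μ,·) ≤ q₀(μ,·)`
  (`cfc_sourcedPressure_sandwich`) with `q₀` the explicit free limit (`cfl_freeSourcedPressure_limit`); hence
  `B` is attained (`danskin_exists_max`), convex on `W` and `2`-Lipschitz there.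
* (2) LOW EDGE chord over `[−99/25, −79/20]`: with `h*` optimal at `−79/20`, the localisation of
  `sourcedColdRegularity_of_freeFacts` (optimality against `h = 0`, sandwich, F1 `stub_freePairEnergyBandBottom`,
  F2 `stub_freeDensityBandBottom`, `cfl_q0_increment_bracket`) gives `|h*| ≤ 10⁻³`, and then
  `B(−79/20) − B(−99/25) ≤ q(−79/20,h*) − q(−99/25,h*) ≤ (1/100 + U/2)/10 ≤ (1−δ)/100`.
  HIGH EDGE chord over `[−1/100000, −1/200000]`: with `h₂` optimal at `−1/100000`,
  `B(−1/200000) − B(−1/100000) ≥ (1/200000 − U/2)(19/20) ≥ (1−δ)/200000` (sandwich, bracket,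
  F3 `stub_freeDensityNearHalfFilling`).
* (3) SWEEP (`ces_subgradient_sweep`, pure convex analysis): minimise the convex continuous `B − (1−δ)·id` over
  `[−99/25, −1/200000]`; the three-chord inequality and the two edge chords push the inequality out to the
  whole window.
[folklore composition; Hiriart-Urruty–Lemaréchal, Convex Analysis and Minimization Algorithms I, §I.4 and §VI.4.4]
-/

set_option linter.dupNamespace false

namespace Summit.HubbardSuperconductivity.HubbardSuperconductivity.Theorems.TwSeededEnsembleEquivalenceR.ColdFloorLine

open Matrix Filter Topology Finset Literature.MathematicalPhysics.QuantumLattice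
open scoped ComplexOrder
open Real MeasureTheory intervalIntegral

noncomputable section

/-! ### The subgradient sweep (pure convex analysis on an interval) -/

/-- **Subgradient sweep.** Let `B` be convex and Lipschitz on the window `[w₁, w₂]`, and let
`w₁ ≤ μl < μm ≤ w₂`, `w₁ ≤ μh < μr ≤ w₂`, `μl ≤ μr`. If the chord of `B` over `[μl, μm]` has slope `≤ s` and
the chord over `[μh, μr]` has slope `≥ s`, then `s` is a subgradient of `B` relative to the whole window at
some `μs ∈ [μl, μr]`: take a minimiser `μs` of the convex continuous `φ = B − s·id` on the compact `[μl, μr]`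
(extreme value theorem); left of `μl` the three-chord inequality gives `slope(φ; μ', μl) ≤ slope(φ; μl, μm) ≤ 0`,
right of `μr` it gives `slope(φ; μr, μ') ≥ slope(φ; μh, μr) ≥ 0`, and in between minimality applies.
[folklore; Hiriart-Urruty–Lemaréchal I, §I.4] -/
theorem ces_subgradient_sweep {B : ℝ → ℝ} {C s w₁ w₂ μl μm μh μr : ℝ}
    (hconv : ConvexOn ℝ (Set.Icc w₁ w₂) B)
    (hLip : ∀ x ∈ Set.Icc w₁ w₂, ∀ y ∈ Set.Icc w₁ w₂, |B x - B y| ≤ C * |x - y|)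
    (hw₁ : w₁ ≤ μl) (hlm : μl < μm) (hm : μm ≤ w₂) (hh : w₁ ≤ μh) (hhr : μh < μr) (hr : μr ≤ w₂)
    (hlr : μl ≤ μr) (hlow : B μm - B μl ≤ s * (μm - μl)) (hhigh : s * (μr - μh) ≤ B μr - B μh) :
    ∃ μs ∈ Set.Icc μl μr, ∀ μ' ∈ Set.Icc w₁ w₂, B μs + s * (μ' - μs) ≤ B μ' := by
  set φ : ℝ → ℝ := fun μ => B μ - s * μ with hφdef
  have hφconv : ConvexOn ℝ (Set.Icc w₁ w₂) φ := by
    refine ⟨hconv.1, fun x hx y hy a b ha hb hab => ?_⟩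
    have key := hconv.2 hx hy ha hb hab
    simp only [hφdef, smul_eq_mul] at key ⊢
    obtain rfl : b = 1 - a := by linarith
    linarith
  have hφcont : ContinuousOn φ (Set.Icc μl μr) := by
    have hBc : ContinuousOn B (Set.Icc w₁ w₂) := danskin_continuousOn_of_lipschitz hLip
    have hlin : ContinuousOn (fun μ : ℝ => s * μ) (Set.Icc μl μr) := (continuous_const_mul s).continuousOn
    exact (hBc.mono (Set.Icc_subset_Icc hw₁ hr)).sub hlin
  obtain ⟨μs, hμs, hmin⟩ := isCompact_Icc.exists_isMinOn (Set.nonempty_Icc.2 hlr) hφcont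
  rw [isMinOn_iff] at hmin
  refine ⟨μs, hμs, fun μ' hμ' => ?_⟩
  have key : φ μs ≤ φ μ' := by
    rcases lt_or_ge μ' μl with h1 | h1
    · -- left of `μl`: slope(φ; μ', μl) ≤ slope(φ; μl, μm) ≤ 0
      have hsl := hφconv.slope_mono_adjacent hμ' ⟨by linarith, hm⟩ h1 hlm
      have hnum : φ μm - φ μl ≤ 0 := by
        simp only [hφdef]
        linarith
      have h2 : (φ μm - φ μl) / (μm - μl) ≤ 0 := div_nonpos_of_nonpos_of_nonneg hnum (by linarith)
      have h3 : φ μl - φ μ' ≤ 0 := by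
        have := hsl.trans h2
        rwa [div_le_iff₀ (by linarith : (0 : ℝ) < μl - μ'), zero_mul] at this
      linarith [hmin μl ⟨le_rfl, hlr⟩]
    rcases le_or_gt μ' μr with h2 | h2
    · exact hmin μ' ⟨h1, h2⟩
    · -- right of `μr`: 0 ≤ slope(φ; μh, μr) ≤ slope(φ; μr, μ')
      have hsl := hφconv.slope_mono_adjacent ⟨hh, by linarith⟩ hμ' hhr h2
      have hnum : 0 ≤ φ μr - φ μh := by
        simp only [hφdef]
        linarith
      have h3 : 0 ≤ (φ μr - φ μh) / (μr - μh) := div_nonneg hnum (by linarith)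
      have h4 : 0 ≤ φ μ' - φ μr := by
        have := h3.trans hsl
        rwa [le_div_iff₀ (by linarith : (0 : ℝ) < μ' - μr), zero_mul] at this
      linarith [hmin μr ⟨hlr, le_rfl⟩]
  simp only [hφdef] at key
  linarith

/-! ### S7a — EDGE in subgradient form + sweep -/

/-- **S7a `stub_coldEdgeSweep`** (registered stub of skeleton v8.1, line `Sketch`, crux
stmt-HubbardSuperconductivity-15581; statement verbatim). For `δ ∈ [1/10, 2/5]`, at the cold slice
`β = e^{a/U} ≥ 20000` (`0 < U ≤ 10⁻⁷`, `0 < g ≤ 1/10`), if `q` is the thermodynamic limit of the sourced torus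
pressure on the window `[−399/100, −1/400000]` × box `[−(13g+1), 13g+1]`, then there is
`μs ∈ [−99/25, −1/200000]` at which `1 − δ` is a subgradient, relative to the whole window, of the limiting
seeded pressure `B(μ) = sSup ((h ↦ q μ h − h²/g) '' box)`. Proof: inherited convexity / Lipschitz bounds / free
sandwich for `q`; LOW EDGE chord `≤ (1/100 + U/2)/10` over `[−99/25, −79/20]` (localisation `|h*| ≤ 10⁻³` + F1 +
F2), HIGH EDGE chord `≥ (1/200000 − U/2)(19/20)` over `[−1/100000, −1/200000]` (F3); then
`ces_subgradient_sweep`. [folklore composition] -/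
theorem stub_coldEdgeSweep :
    ∀ δ ∈ Set.Icc (1/10 : ℝ) (2/5 : ℝ), ∀ (a U g : ℝ), 0 < a → 0 < U → U ≤ 1 / 10000000 →
      (20000 : ℝ) ≤ Real.exp (a / U) → 0 < g → g ≤ 1 / 10 → ∀ q : ℝ → ℝ → ℝ,
        (∀ μ ∈ Set.Icc (-(399 / 100) : ℝ) (-(1 / 400000) : ℝ), ∀ h ∈ Set.Icc (-(13 * g + 1)) (13 * g + 1), ∀ κ : ℝ, 0 < κ →
            ∃ L₀ : ℕ, ∀ (L : ℕ) [NeZero L], L₀ ≤ L →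
              |Real.log (Matrix.partitionFn (Real.exp (a / U)) (dWaveSourceTorus L U μ h)).re /
                  (Real.exp (a / U) * (L : ℝ) ^ 2) - q μ h| ≤ κ) →
        ∃ μs ∈ Set.Icc (-(99 / 25) : ℝ) (-(1 / 200000) : ℝ), ∀ μ' ∈ Set.Icc (-(399 / 100) : ℝ) (-(1 / 400000) : ℝ),
          sSup ((fun h' : ℝ => q μs h' - h' ^ 2 / g) '' Set.Icc (-(13 * g + 1)) (13 * g + 1)) + (1 - δ) * (μ' - μs) ≤ sSup ((fun h' : ℝ => q μ' h' - h' ^ 2 / g) '' Set.Icc (-(13 * g + 1)) (13 * g + 1)) := by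
  intro δ hδ a U g _ hUpos hUsmall hβB hg0 hg1 q hq
  set β : ℝ := Real.exp (a / U) with hβdef
  have hβ : 0 < β := Real.exp_pos _
  have hβ200 : 200 ≤ β := by linarith
  have hg10 : 10 ≤ 1 / g := by
    rw [le_div_iff₀ hg0]
    linarith
  set H : ℝ := 13 * g + 1 with hHdef
  have hH : 0 ≤ H := by positivity
  have hu0 : 0 ≤ U / 2 := by linarith
  have h0S : (0 : ℝ) ∈ Set.Icc (-H) H := ⟨by linarith, hH⟩
  -- sequences `n ↦ p̃_{n+1}` on window × box
  have hseq : ∀ μ ∈ Set.Icc (-(399 / 100) : ℝ) (-(1 / 400000)), ∀ h ∈ Set.Icc (-H) H, ∀ κ : ℝ, 0 < κ →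
      ∃ N : ℕ, ∀ n, N ≤ n →
        |Real.log (partitionFn β (dWaveSourceTorus (n + 1) U μ h)).re / (β * (((n + 1 : ℕ) : ℝ)) ^ 2) -
          q μ h| ≤ κ := by
    intro μ hμ h hh κ hκ
    obtain ⟨L₀, hL₀⟩ := hq μ hμ h hh κ hκ
    exact ⟨L₀, fun n hn => hL₀ (n + 1) (by omega)⟩
  -- the free limit pressure, named `q₀f`, IS the explicit Brillouin-zone integral
  obtain ⟨q₀f, hqI⟩ : ∃ q₀f : ℝ → ℝ → ℝ, ∀ μ h : ℝ, q₀f μ h =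
      (∫ θ₁ in (0 : ℝ)..2 * π, ∫ θ₂ in (0 : ℝ)..2 * π, (2 * Real.log 2 / β - (-2 * (Real.cos θ₁ + Real.cos θ₂) - μ) + 1 / β * Real.log ((1 + Real.cosh (β * Real.sqrt ((-2 * (Real.cos θ₁ + Real.cos θ₂) - μ) ^ 2 + (2 * Real.sqrt 2 * h * (Real.cos θ₁ - Real.cos θ₂)) ^ 2))) / 2))) / (4 * π ^ 2) :=
    ⟨_, fun _ _ => rfl⟩
  have hq₀f : ∀ μ h : ℝ, ∀ κ : ℝ, 0 < κ → ∃ L₀ : ℕ, ∀ (L : ℕ) [NeZero L], L₀ ≤ L →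
      |Real.log (partitionFn β (dWaveSourceTorus L 0 μ h)).re / (β * (L : ℝ) ^ 2) - q₀f μ h| ≤ κ := by
    intro μ h κ hκ
    rw [hqI]
    exact cfl_freeSourcedPressure_limit β μ h hβ κ hκ
  have hseq0 : ∀ μ h : ℝ, ∀ κ : ℝ, 0 < κ → ∃ N : ℕ, ∀ n, N ≤ n →
      |Real.log (partitionFn β (dWaveSourceTorus (n + 1) 0 μ h)).re / (β * (((n + 1 : ℕ) : ℝ)) ^ 2) -
        q₀f μ h| ≤ κ := by
    intro μ h κ hκ
    obtain ⟨L₀, hL₀⟩ := hq₀f μ h κ hκ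
    exact ⟨L₀, fun n hn => hL₀ (n + 1) (by omega)⟩
  -- (1) inherited `h`-Lipschitz and `μ`-Lipschitz bounds, `μ`-convexity on the window, sandwich in the limit
  set Cd : ℝ := 2 * (2 * ∑ e ∈ insert (0 : Literature.Probability.LatticeModels.Site 2)
    unitSteps, |dWaveFormFactor e / Real.sqrt 2|) with hCd
  have hLh : ∀ μ ∈ Set.Icc (-(399 / 100) : ℝ) (-(1 / 400000)), ∀ h ∈ Set.Icc (-H) H, ∀ h' ∈ Set.Icc (-H) H,
      |q μ h - q μ h'| ≤ Cd * |h - h'| := by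
    intro μ hμ h hh h' hh'
    refine cfb_abs_sub_le_of_limits (hseq μ hμ h hh) (hseq μ hμ h' hh') fun n => ?_
    have := cfc_abs_sourcedPressure_sub_h_le (n + 1) U μ hβ h h'
    exact_mod_cast this
  have hLμ : ∀ μ ∈ Set.Icc (-(399 / 100) : ℝ) (-(1 / 400000)), ∀ μ' ∈ Set.Icc (-(399 / 100) : ℝ) (-(1 / 400000)),
      ∀ h ∈ Set.Icc (-H) H, |q μ h - q μ' h| ≤ 2 * |μ - μ'| := by
    intro μ hμ μ' hμ' h hh
    refine cfb_abs_sub_le_of_limits (hseq μ hμ h hh) (hseq μ' hμ' h hh) fun n => ?_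
    have := cfb_abs_sourcedPressure_sub_mu_le (n + 1) U h hβ μ μ'
    exact_mod_cast this
  have hconvW : ∀ h ∈ Set.Icc (-H) H,
      ConvexOn ℝ (Set.Icc (-(399 / 100) : ℝ) (-(1 / 400000))) (fun μ => q μ h) := by
    intro h hh
    refine cfc_convexOn_of_limit (convex_Icc _ _) (f := fun n μ =>
      Real.log (partitionFn β (dWaveSourceTorus (n + 1) U μ h)).re / (β * (((n + 1 : ℕ) : ℝ)) ^ 2))
      (fun n => ?_) (fun μ hμ κ hκ => hseq μ hμ h hh κ hκ)
    have := (cfb_convexOn_sourcedPressure (n + 1) U h hβ).subset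
      (Set.subset_univ (Set.Icc (-(399 / 100) : ℝ) (-(1 / 400000)))) (convex_Icc (-(399 / 100) : ℝ) (-(1 / 400000)))
    simpa using this
  have hupper : ∀ μ ∈ Set.Icc (-(399 / 100) : ℝ) (-(1 / 400000)), ∀ h ∈ Set.Icc (-H) H, q μ h ≤ q₀f μ h := by
    intro μ hμ h hh
    refine cfb_le_of_limits (hseq μ hμ h hh) (hseq0 μ h) fun n => ?_
    have := (cfc_sourcedPressure_sandwich (n + 1) hUpos.le hβ μ h).2
    simpa using this
  have hlower : ∀ μ ∈ Set.Icc (-(399 / 100) : ℝ) (-(1 / 400000)), ∀ h ∈ Set.Icc (-H) H,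
      q₀f (μ - U / 2) h ≤ q μ h := by
    intro μ hμ h hh
    refine cfb_le_of_limits (hseq0 (μ - U / 2) h) (hseq μ hμ h hh) fun n => ?_
    have := (cfc_sourcedPressure_sandwich (n + 1) hUpos.le hβ μ h).1
    simpa using this
  -- the limiting seeded pressure `B`: attained, convex and `2`-Lipschitz on the window
  set B : ℝ → ℝ := fun μ => sSup ((fun h' : ℝ => q μ h' - h' ^ 2 / g) '' Set.Icc (-H) H) with hBdef
  have hmaxex : ∀ μ ∈ Set.Icc (-(399 / 100) : ℝ) (-(1 / 400000)), ∃ hm ∈ Set.Icc (-H) H,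
      (∀ h' ∈ Set.Icc (-H) H, q μ h' - h' ^ 2 / g ≤ q μ hm - hm ^ 2 / g) ∧ B μ = q μ hm - hm ^ 2 / g := by
    intro μ hμ
    obtain ⟨hm, hmS, hmax, hsup⟩ := danskin_exists_max (fun _ h => q μ h) g hH (fun _ => hLh μ hμ) μ
    exact ⟨hm, hmS, hmax, hsup⟩
  have hBge : ∀ μ ∈ Set.Icc (-(399 / 100) : ℝ) (-(1 / 400000)), ∀ h ∈ Set.Icc (-H) H,
      q μ h - h ^ 2 / g ≤ B μ := by
    intro μ hμ h hh
    obtain ⟨hm, hmS, hmax, hBm⟩ := hmaxex μ hμ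
    rw [hBm]
    exact hmax h hh
  have hBconv : ConvexOn ℝ (Set.Icc (-(399 / 100) : ℝ) (-(1 / 400000))) B := by
    refine ⟨convex_Icc _ _, fun x hx y hy a' b' ha' hb' hab' => ?_⟩
    have hz : a' • x + b' • y ∈ Set.Icc (-(399 / 100) : ℝ) (-(1 / 400000)) :=
      (convex_Icc _ _) hx hy ha' hb' hab'
    obtain ⟨hm, hmS, -, hBz⟩ := hmaxex _ hz
    have hc := (hconvW hm hmS).2 hx hy ha' hb' hab'
    have h1 := mul_le_mul_of_nonneg_left (hBge x hx hm hmS) ha'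
    have h2 := mul_le_mul_of_nonneg_left (hBge y hy hm hmS) hb'
    rw [hBz]
    simp only [smul_eq_mul] at hc ⊢
    obtain rfl : b' = 1 - a' := by linarith
    linarith
  have hBlip : ∀ x ∈ Set.Icc (-(399 / 100) : ℝ) (-(1 / 400000)), ∀ y ∈ Set.Icc (-(399 / 100) : ℝ) (-(1 / 400000)),
      |B x - B y| ≤ 2 * |x - y| := by
    intro x hx y hy
    obtain ⟨hx', hxS, -, hBx⟩ := hmaxex x hx
    obtain ⟨hy', hyS, -, hBy⟩ := hmaxex y hy
    have h1 := hBge y hy hx' hxS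
    have h2 := hBge x hx hy' hyS
    have h3 := hLμ x hx y hy hx' hxS
    have h4 := hLμ x hx y hy hy' hyS
    rw [abs_le] at h3 h4 ⊢
    constructor <;> linarith
  -- (2) LOW EDGE chord over `[−99/25, −79/20]`
  have hμmW : (-(79 / 20) : ℝ) ∈ Set.Icc (-(399 / 100) : ℝ) (-(1 / 400000)) := ⟨by norm_num, by norm_num⟩
  have hμlW : (-(99 / 25) : ℝ) ∈ Set.Icc (-(399 / 100) : ℝ) (-(1 / 400000)) := ⟨by norm_num, by norm_num⟩
  have hlowE : B (-(79 / 20)) - B (-(99 / 25)) ≤ (1 / 100 + U / 2) * (1 / 10) := by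
    obtain ⟨hs, hsS, hmax, hsup⟩ := hmaxex (-(79 / 20)) hμmW
    -- (i) localisation of the optimal source: |hs| ≤ 10⁻³
    have hopt : q (-(79 / 20)) 0 - 0 ^ 2 / g ≤ q (-(79 / 20)) hs - hs ^ 2 / g := hmax 0 h0S
    have hopt' : hs ^ 2 / g ≤ q (-(79 / 20)) hs - q (-(79 / 20)) 0 := by
      have e0 : (0 : ℝ) ^ 2 / g = 0 := by simp
      linarith
    have ha1 := hupper (-(79 / 20)) hμmW hs hsS
    have ha2 := hlower (-(79 / 20)) hμmW 0 h0S
    have hF1' : q₀f (-(79 / 20)) hs - q₀f (-(79 / 20)) 0 ≤ 4 * hs ^ 2 + Real.sqrt 2 / 400 * |hs| := by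
      rw [hqI, hqI]
      exact stub_freePairEnergyBandBottom β hs hβ
    have hbr0 := (cfl_q0_increment_bracket β 0 hβ (fun μ => q₀f μ 0) (fun μ _ κ hκ => hq₀f μ 0 κ hκ)
      (μ₁ := -(79 / 20)) (μ₂ := -(79 / 20) - U / 2) ⟨by norm_num, by norm_num⟩ ⟨by linarith, by linarith⟩
      (by linarith)).2
    have hN0 := stub_freeDensityBandBottom β 0 (-(79 / 20)) hβ200 (by norm_num) ⟨by norm_num, by norm_num⟩
    have hinc0 : q₀f (-(79 / 20)) 0 - q₀f (-(79 / 20) - U / 2) 0 ≤ U / 2 * (1 / 10) := by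
      have e : (-(79 / 20) - (-(79 / 20) - U / 2) : ℝ) = U / 2 := by ring
      rw [e] at hbr0
      exact hbr0.trans (mul_le_mul_of_nonneg_left hN0 hu0)
    have hsq : 10 * hs ^ 2 ≤ hs ^ 2 / g := by
      calc 10 * hs ^ 2 = hs ^ 2 * 10 := by ring
        _ ≤ hs ^ 2 * (1 / g) := mul_le_mul_of_nonneg_left hg10 (sq_nonneg _)
        _ = hs ^ 2 / g := by ring
    have hloc : 6 * hs ^ 2 ≤ Real.sqrt 2 / 400 * |hs| + U / 2 * (1 / 10) := by linarith
    have hs2 : Real.sqrt 2 ≤ 3 / 2 := by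
      rw [show (3 / 2 : ℝ) = Real.sqrt ((3 / 2) ^ 2) by rw [Real.sqrt_sq (by norm_num)]]
      exact Real.sqrt_le_sqrt (by norm_num)
    have hsmall : |hs| ≤ 1 / 1000 := by
      by_contra hcon
      rw [not_le] at hcon
      have habs : 0 ≤ |hs| := abs_nonneg hs
      have hsqa : hs ^ 2 = |hs| ^ 2 := (sq_abs hs).symm
      have hprod : 0 ≤ 6 * |hs| * (|hs| - 1 / 1000) := by
        have : 0 ≤ |hs| - 1 / 1000 := by linarith
        positivity
      nlinarith [hloc, hcon, hUsmall, hs2, hsqa, habs, hprod]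
    -- (ii) chord ≤ q(μm,h*) − q(μl,h*) ≤ free increment over [μl − U/2, μm] ≤ (1/100 + U/2)/10
    have hBl := hBge (-(99 / 25)) hμlW hs hsS
    have h4 := hlower (-(99 / 25)) hμlW hs hsS
    have hbr := (cfl_q0_increment_bracket β hs hβ (fun μ => q₀f μ hs) (fun μ _ κ hκ => hq₀f μ hs κ hκ)
      (μ₁ := -(79 / 20)) (μ₂ := -(99 / 25) - U / 2) ⟨by norm_num, by norm_num⟩
      ⟨by linarith, by linarith⟩ (by linarith)).2
    have hN := stub_freeDensityBandBottom β hs (-(79 / 20)) hβ200 hsmall ⟨by norm_num, by norm_num⟩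
    have hinc : q₀f (-(79 / 20)) hs - q₀f (-(99 / 25) - U / 2) hs ≤ (1 / 100 + U / 2) * (1 / 10) := by
      have e : (-(79 / 20) - (-(99 / 25) - U / 2) : ℝ) = 1 / 100 + U / 2 := by ring
      rw [e] at hbr
      exact hbr.trans (mul_le_mul_of_nonneg_left hN (by linarith))
    rw [hsup]
    linarith
  -- (2') HIGH EDGE chord over `[−1/100000, −1/200000]`
  have hμrW : (-(1 / 200000) : ℝ) ∈ Set.Icc (-(399 / 100) : ℝ) (-(1 / 400000)) := ⟨by norm_num, by norm_num⟩
  have hμhW : (-(1 / 100000) : ℝ) ∈ Set.Icc (-(399 / 100) : ℝ) (-(1 / 400000)) := ⟨by norm_num, by norm_num⟩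
  have hhighE : (1 / 200000 - U / 2) * (19 / 20) ≤ B (-(1 / 200000)) - B (-(1 / 100000)) := by
    obtain ⟨hs, hsS, -, hsup⟩ := hmaxex (-(1 / 100000)) hμhW
    have hBr := hBge (-(1 / 200000)) hμrW hs hsS
    have h1 := hlower (-(1 / 200000)) hμrW hs hsS
    have h2 := hupper (-(1 / 100000)) hμhW hs hsS
    have hbr := (cfl_q0_increment_bracket β hs hβ (fun μ => q₀f μ hs) (fun μ _ κ hκ => hq₀f μ hs κ hκ)
      (μ₁ := -(1 / 200000) - U / 2) (μ₂ := -(1 / 100000)) ⟨by linarith, by linarith⟩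
      ⟨by norm_num, by norm_num⟩ (by linarith)).1
    have hN := stub_freeDensityNearHalfFilling β hs (-(1 / 100000)) hβB ⟨by norm_num, by norm_num⟩
    have hinc : (1 / 200000 - U / 2) * (19 / 20) ≤
        q₀f (-(1 / 200000) - U / 2) hs - q₀f (-(1 / 100000)) hs := by
      have e : (-(1 / 200000) - U / 2 - -(1 / 100000) : ℝ) = 1 / 200000 - U / 2 := by ring
      rw [e] at hbr
      exact le_trans (mul_le_mul_of_nonneg_left hN (by linarith)) hbr
    rw [hsup]
    linarith
  -- (3) SWEEP
  have hs_low : B (-(79 / 20)) - B (-(99 / 25)) ≤ (1 - δ) * (-(79 / 20) - -(99 / 25)) := by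
    have e : (-(79 / 20) - -(99 / 25) : ℝ) = 1 / 100 := by norm_num
    rw [e]
    linarith [hδ.2]
  have hs_high : (1 - δ) * (-(1 / 200000) - -(1 / 100000)) ≤ B (-(1 / 200000)) - B (-(1 / 100000)) := by
    have e : (-(1 / 200000) - -(1 / 100000) : ℝ) = 1 / 200000 := by norm_num
    rw [e]
    linarith [hδ.1]
  obtain ⟨μs, hμs, hfin⟩ := ces_subgradient_sweep hBconv hBlip (μl := -(99 / 25)) (μm := -(79 / 20))
    (μh := -(1 / 100000)) (μr := -(1 / 200000)) (by norm_num) (by norm_num) (by norm_num) (by norm_num)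
    (by norm_num) (by norm_num) (by norm_num) hs_low hs_high
  exact ⟨μs, hμs, hfin⟩

end

end Summit.HubbardSuperconductivity.HubbardSuperconductivity.Theorems.TwSeededEnsembleEquivalenceR.ColdFloorLine
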